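import Literature.NumberTheory.Sieve.HeathBrownCubicLemma51
import Literature.NumberTheory.Sieve.HeathBrownCubicLemma47
import HarnessLib

/-!
# Heath-Brown's Type I estimate, Lemma 3.2 (`HeathBrown2001_typeI_A`): the discharge

Pure-proof file closing the named fact `HeathBrown2001_typeI_A` of `HeathBrownCubicSieveSetup`
(D. R. Heath-Brown, *Primes represented by `x³ + 2y³`*, Acta Math. 186 (2001), 1–84, **Lemma 3.2**,
p. 11; proof §5, pp. 28–32, from Lemmas 4.7 and 5.1):

* `HeathBrownCubicTypeIProofs.HeathBrown2001_typeI_A_of_bounds` — Lemma 3.2 from the statements of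
  Lemmas 4.7 and 5.1 (pp. 31–32);
* `HeathBrownCubicLemma51.lemma_5_1_bound_of_lemma_4_7_bound` — Lemma 5.1 from Lemma 4.7 (pp. 28–30);
* `HeathBrownCubicLemma47.HeathBrown2001_lemma_4_7` (the Lemma 3.10 decomposition) — Lemma 4.7 for
  boxes `|m| ≤ X`, `|n| ≤ Y` with `Y ≤ X`.

The dyadic treatment of `Σ₁` (p. 30) uses Lemma 4.7 for boxes of both shapes; the case `X ≤ Y` (many
`n`, few `m`) is Lemma 4.6 with the roles of `α = 1`, `β = 2^{1/3}` exchanged ("we may assume `x ≥ y` by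
symmetry", p. 24). It is proved here (`sum_box_pow_le_of_le`) by the argument of
`HeathBrownCubicLemma47` with the transposed count: for fixed `m` the `n` with `m + n·2^{1/3} ∈ J` lie in
one residue class modulo `ν(J)/gcd(ν(J), 2) ≥ ν(J)/2`, because `n·2^{1/3} ∈ J` forces
`2n = n·2^{1/3}·2^{2/3} ∈ J` (`card_filter_add_intCast_mul_mem_le`). Together:
`lemma_4_7_bound_holds` (Lemma 4.7 for all real `x, y ≥ 2`, in the rendering of
`HeathBrownCubicTypeIProofs`) and **`HeathBrown2001_typeI_A_holds`**.

## References

* D. R. Heath-Brown, *Primes represented by `x³ + 2y³`*, Acta Math. 186 (2001), 1–84: Lemma 3.2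
  (p. 11), Lemmas 4.6–4.7 (pp. 24–25), Lemma 5.1 (pp. 28–30), pp. 31–32.
  [cite: HeathBrownActa2001, Lemma 3.2]

## Mathlib / tree search

`Int.ModEq.cancel_left_div_gcd`, `Int.modEq_iff_dvd`, `Int.natCast_floor_eq_floor`; tree:
`HeathBrownCubicLemma47` (`HeathBrown2001_lemma_4_7`, `intCast_add_mul_θint_eq_coordElt`),
`HeathBrownCubicNuSum` (`idealNu`, `intCast_mem_iff_idealNu_dvd`, `idealNu_pos`,
`exists_sum_nuWeight_le`), `HeathBrownCubicLemma44` (`HeathBrown2001_lemma_4_4`),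
`HeathBrownCubicLemma45` (`absNorm_span_coordElt_le`), `HeathBrownCubicLatticeCount`
(`coordElt_injective`, `card_Ioc_filter_modEq_le`), `HeathBrownCubicSieveSetupProofs`
(`exists_sum_idealDivisorCount_pow_le`), `CubeRootTwoField` (`coe_θint`, `θ_pow_three`).
-/

noncomputable section

open NumberField Finset

namespace Literature.NumberTheory.Sieve.CubicSieve

open LFunctions.CubeRootTwoField

/-! ### The transposed count: fixed `m`, `n` in a box -/

/-- `(2^{1/3})³ = 2` in `𝓞_K`. [folklore] -/
theorem θint_pow_three : (θint : 𝓞 K) ^ 3 = 2 := by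
  apply RingOfIntegers.coe_injective
  simp only [map_pow, show algebraMap (𝓞 K) K θint = θ from rfl, θ_pow_three, map_ofNat]

open scoped Classical in
/-- For fixed `m`, the integers `n ∈ [−Y, Y]` with `m + n·2^{1/3} ∈ J` lie in one residue class
modulo `ν(J)/gcd(ν(J), 2) ≥ ν(J)/2` (if `n·2^{1/3} ∈ J` then `2n = n·2^{1/3}·2^{2/3} ∈ J`, so
`ν(J) ∣ 2n`), hence there are at most `4Y/ν(J) + 1` of them (`J ≠ 0`) — the count of p. 24 with the
roles of `1` and `2^{1/3}` exchanged. [cite: HeathBrownActa2001, §4 p. 24] -/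
theorem card_filter_add_intCast_mul_mem_le {J : Ideal (𝓞 K)} (hJ : J ≠ ⊥) (Y : ℕ) (m : ℤ) :
    (#((Icc (-(Y : ℤ)) Y).filter (fun n : ℤ => (m : 𝓞 K) + (n : 𝓞 K) * θint ∈ J)) : ℝ) ≤
      4 * Y / idealNu J + 1 := by
  classical
  set F := (Icc (-(Y : ℤ)) Y).filter (fun n : ℤ => (m : 𝓞 K) + (n : 𝓞 K) * θint ∈ J) with hF
  have hν := idealNu_pos hJ
  have hν' : (0 : ℝ) < idealNu J := by exact_mod_cast hν
  set d : ℤ := (idealNu J : ℕ) / ((idealNu J : ℕ) : ℤ).gcd 2 with hd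
  have hg0 : 0 < ((idealNu J : ℕ) : ℤ).gcd 2 := Int.gcd_pos_of_ne_zero_right _ (by norm_num)
  have hg2 : ((idealNu J : ℕ) : ℤ).gcd 2 ≤ 2 :=
    Nat.le_of_dvd two_pos (Int.natCast_dvd_natCast.mp (Int.gcd_dvd_right ((idealNu J : ℕ) : ℤ) 2))
  have hgd : (((idealNu J : ℕ) : ℤ).gcd 2 : ℤ) ∣ ((idealNu J : ℕ) : ℤ) := Int.gcd_dvd_left ..
  have hdmul : d * (((idealNu J : ℕ) : ℤ).gcd 2 : ℤ) = ((idealNu J : ℕ) : ℤ) := Int.ediv_mul_cancel hgd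
  have hd0 : 0 < d := by
    rcases lt_trichotomy d 0 with h | h | h
    · nlinarith
    · rw [h, zero_mul] at hdmul; exact absurd hdmul (by exact_mod_cast hν.ne)
    · exact h
  have hdν : (idealNu J : ℝ) ≤ 2 * (d : ℝ) := by
    have h1 : ((idealNu J : ℕ) : ℤ) ≤ 2 * d := by
      calc ((idealNu J : ℕ) : ℤ) = d * (((idealNu J : ℕ) : ℤ).gcd 2 : ℤ) := hdmul.symm
        _ ≤ d * 2 := mul_le_mul_of_nonneg_left (by exact_mod_cast hg2) hd0.le
        _ = 2 * d := mul_comm _ _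
    exact_mod_cast h1
  obtain ⟨dn, hdn⟩ : ∃ dn : ℕ, (dn : ℤ) = d := ⟨d.toNat, Int.toNat_of_nonneg hd0.le⟩
  have hdn0 : 0 < dn := by omega
  rcases F.eq_empty_or_nonempty with h0 | ⟨n₀, hn₀⟩
  · rw [h0, card_empty, Nat.cast_zero]; positivity
  · have hn₀' := (mem_filter.mp hn₀).2
    have hsub : F ⊆ (Ioc (-(Y : ℤ) - 1) Y).filter (fun n => n ≡ n₀ [ZMOD dn]) := by
      intro n hn
      rw [hF, mem_filter, mem_Icc] at hn
      rw [mem_filter, mem_Ioc]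
      refine ⟨⟨by omega, hn.1.2⟩, ?_⟩
      -- `(n - n₀)θ ∈ J`, hence `2(n - n₀) ∈ J`, `ν ∣ 2(n - n₀)`
      have hdiff : (((n - n₀ : ℤ) : 𝓞 K)) * θint ∈ J := by
        have := J.sub_mem hn.2 hn₀'
        push_cast
        convert this using 1
        ring
      have h2 : ((2 * (n - n₀) : ℤ) : 𝓞 K) ∈ J := by
        have := J.mul_mem_left (θint ^ 2) hdiff
        convert this using 1
        push_cast
        linear_combination (-(↑n - ↑n₀ : 𝓞 K)) * θint_pow_three
      have hdvd := (intCast_mem_iff_idealNu_dvd J _).mp h2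
      have hmod : 2 * n ≡ 2 * n₀ [ZMOD ((idealNu J : ℕ) : ℤ)] :=
        (Int.modEq_iff_dvd.mpr (by convert hdvd using 1; ring)).symm
      have := Int.ModEq.cancel_left_div_gcd (by exact_mod_cast hν) hmod
      rw [← hd, ← hdn] at this
      exact this
    have hcount := card_Ioc_filter_modEq_le (-(Y : ℤ) - 1) Y hdn0 n₀
    have harith : ((Y : ℤ) - (-(Y : ℤ) - 1) - 1) / (dn : ℕ) + 1 = (2 * Y : ℤ) / (dn : ℕ) + 1 := by
      congr 1; congr 1; ring
    rw [harith] at hcount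
    have hdn' : (0 : ℝ) < dn := by exact_mod_cast hdn0
    have h2 : (((2 * Y : ℤ) / (dn : ℕ) + 1).toNat : ℝ) ≤ 2 * Y / dn + 1 := by
      have hq0 : (0 : ℤ) ≤ (2 * Y : ℤ) / (dn : ℕ) := Int.ediv_nonneg (by positivity) (by positivity)
      rw [← Int.cast_natCast (R := ℝ), Int.toNat_of_nonneg (by linarith)]
      push_cast
      gcongr
      have h3 : (((2 * Y : ℤ) / (dn : ℕ) : ℤ) : ℝ) * dn ≤ 2 * Y := by
        have := Int.ediv_mul_le (2 * Y : ℤ) (b := (dn : ℕ)) (by exact_mod_cast hdn0.ne')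
        exact_mod_cast this
      rw [le_div_iff₀ hdn']
      exact h3
    have h3 : 2 * (Y : ℝ) / dn ≤ 4 * Y / idealNu J := by
      rw [div_le_div_iff₀ hdn' hν']
      have : (d : ℝ) = dn := by exact_mod_cast hdn.symm
      rw [← this]
      nlinarith [hdν, (Y.cast_nonneg : (0 : ℝ) ≤ Y)]
    calc (#F : ℝ) ≤ #((Ioc (-(Y : ℤ) - 1) Y).filter (fun n => n ≡ n₀ [ZMOD dn])) := by
          exact_mod_cast card_le_card hsub
      _ ≤ (((2 * Y : ℤ) / (dn : ℕ) + 1).toNat : ℝ) := by exact_mod_cast hcount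
      _ ≤ 2 * Y / dn + 1 := h2
      _ ≤ 4 * Y / idealNu J + 1 := by linarith

open scoped Classical in
/-- The transposed box count: `#{|m| ≤ X, |n| ≤ Y : m + n·2^{1/3} ∈ J} ≤ (2X + 1)(4Y/ν(J) + 1)`.
[cite: HeathBrownActa2001, §4 p. 24] -/
theorem card_box_filter_mem_le' {J : Ideal (𝓞 K)} (hJ : J ≠ ⊥) (X Y : ℕ) :
    (#(((Icc (-(X : ℤ)) X) ×ˢ (Icc (-(Y : ℤ)) Y)).filter
        (fun v : ℤ × ℤ => (v.1 : 𝓞 K) + (v.2 : 𝓞 K) * θint ∈ J)) : ℝ) ≤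
      (2 * X + 1) * (4 * Y / idealNu J + 1) := by
  classical
  set S := ((Icc (-(X : ℤ)) X) ×ˢ (Icc (-(Y : ℤ)) Y)).filter
    (fun v : ℤ × ℤ => (v.1 : 𝓞 K) + (v.2 : 𝓞 K) * θint ∈ J) with hS
  have hmaps : ∀ v ∈ S, v.1 ∈ Icc (-(X : ℤ)) X := fun v hv =>
    (mem_product.mp (mem_filter.mp hv).1).1
  have hdecomp := card_eq_sum_card_fiberwise hmaps
  have hfib : ∀ m ∈ Icc (-(X : ℤ)) X, (#(S.filter (fun v => v.1 = m)) : ℝ) ≤ 4 * Y / idealNu J + 1 := by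
    intro m _
    refine le_trans ?_ (card_filter_add_intCast_mul_mem_le hJ Y m)
    have h : #(S.filter (fun v => v.1 = m)) ≤
        #((Icc (-(Y : ℤ)) Y).filter (fun n : ℤ => (m : 𝓞 K) + (n : 𝓞 K) * θint ∈ J)) := by
      refine card_le_card_of_injOn (fun v => v.2) ?_ ?_
      · intro v hv
        rw [mem_coe, mem_filter, hS, mem_filter, mem_product] at hv
        obtain ⟨⟨⟨-, h2⟩, hmem⟩, rfl⟩ := hv
        rw [mem_coe, mem_filter]
        exact ⟨h2, hmem⟩
      · intro v hv w hw hvw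
        rw [mem_coe, mem_filter] at hv hw
        exact Prod.ext (hv.2.trans hw.2.symm) hvw
    exact_mod_cast h
  calc (#S : ℝ) = ∑ m ∈ Icc (-(X : ℤ)) X, (#(S.filter (fun v => v.1 = m)) : ℝ) := by
        rw [hdecomp]; push_cast; rfl
    _ ≤ ∑ _m ∈ Icc (-(X : ℤ)) X, (4 * Y / idealNu J + 1 : ℝ) := sum_le_sum hfib
    _ = (2 * X + 1) * (4 * Y / idealNu J + 1) := by
        rw [sum_const, nsmul_eq_mul, Int.card_Icc]
        congr 1
        rw [show ((X : ℤ) + 1 - -(X : ℤ)).toNat = 2 * X + 1 by omega]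
        push_cast; ring

/-! ### Lemma 4.7 for `X ≤ Y` -/

open scoped Classical in
/-- **Lemma 4.7 for boxes with `2 ≤ X ≤ Y`** (Lemma 4.6 with `α = 2^{1/3}`, `β = 1`; "we may assume
`x ≥ y` by symmetry", p. 24): `∑_{|m|≤X, |n|≤Y, (m,n)≠0} τ((m + n·2^{1/3}))^A ≤ C XY (log XY)^e`. The
proof is that of `HeathBrown2001_lemma_4_7` with the transposed count `card_box_filter_mem_le'`.
[cite: HeathBrownActa2001, Lemma 4.7] -/
theorem sum_box_pow_le_of_le (A : ℕ) :
    ∃ C e : ℝ, 0 < C ∧ 0 ≤ e ∧ ∀ X Y : ℕ, 2 ≤ X → X ≤ Y →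
      ∑ v ∈ ((Icc (-(X : ℤ)) X) ×ˢ (Icc (-(Y : ℤ)) Y)).filter (· ≠ 0),
          (idealDivisorCount (Ideal.span {(v.1 : 𝓞 K) + (v.2 : 𝓞 K) * θint}) : ℝ) ^ A ≤
        C * X * Y * Real.log ((X : ℝ) * Y) ^ e := by
  obtain ⟨c, hc⟩ : ∃ c : ℕ, c = 23 * A := ⟨_, rfl⟩
  obtain ⟨C₁, e₁, hC₁, he₁, hν⟩ := exists_sum_nuWeight_le c
  obtain ⟨C₂, hC₂, h42⟩ := exists_sum_idealDivisorCount_pow_le c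
  obtain ⟨e₂, he₂⟩ : ∃ e₂ : ℕ, e₂ = 2 ^ (4 * c + 4) := ⟨_, rfl⟩
  rw [← he₂] at h42
  set E : ℝ := max e₁ e₂ with hE
  refine ⟨2 ^ (11 * A) * 3 * (4 * C₁ + C₂), E, by positivity, le_max_of_le_left he₁, ?_⟩
  intro X Y hX hXY
  have hY : 2 ≤ Y := hX.trans hXY
  have hX' : (2 : ℝ) ≤ X := by exact_mod_cast hX
  have hY' : (2 : ℝ) ≤ Y := by exact_mod_cast hY
  have hXY' : (X : ℝ) ≤ Y := by exact_mod_cast hXY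
  have hYpos : (0 : ℝ) < Y := by linarith
  set Box := ((Icc (-(X : ℤ)) X) ×ˢ (Icc (-(Y : ℤ)) Y)).filter (· ≠ (0 : ℤ × ℤ)) with hBox
  set T := (idealsLE Y).filter (· ≠ (⊥ : Ideal (𝓞 K))) with hT
  have hlogY : 0 < Real.log Y := Real.log_pos (by linarith)
  have hlogXY1 : 1 ≤ Real.log ((X : ℝ) * Y) := by
    have h4 : (4 : ℝ) ≤ (X : ℝ) * Y := by nlinarith
    have : Real.log 4 ≤ Real.log ((X : ℝ) * Y) := Real.log_le_log (by norm_num) h4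
    have h2 : (1 : ℝ) ≤ Real.log 4 := by
      rw [show (4 : ℝ) = 2 ^ 2 by norm_num, Real.log_pow]
      have := Real.log_two_gt_d9; push_cast; linarith
    linarith
  have hlogY_le : Real.log Y ≤ Real.log ((X : ℝ) * Y) :=
    Real.log_le_log hYpos (by nlinarith)
  have hpowY : ∀ {t : ℝ}, 0 ≤ t → t ≤ E → Real.log Y ^ t ≤ Real.log ((X : ℝ) * Y) ^ E := by
    intro t ht htE
    calc Real.log Y ^ t ≤ Real.log ((X : ℝ) * Y) ^ t := Real.rpow_le_rpow hlogY.le hlogY_le ht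
      _ ≤ Real.log ((X : ℝ) * Y) ^ E := Real.rpow_le_rpow_of_exponent_le hlogXY1 htE
  -- Step 1: pointwise bound via Lemma 4.4 with `n = 12`
  have hpt : ∀ v ∈ Box, (idealDivisorCount (Ideal.span {(v.1 : 𝓞 K) + (v.2 : 𝓞 K) * θint}) : ℝ) ^ A ≤
      2 ^ (11 * A) * ∑ J ∈ T.filter (fun J => (v.1 : 𝓞 K) + (v.2 : 𝓞 K) * θint ∈ J),
        (idealDivisorCount J : ℝ) ^ c := by
    intro v hv
    rw [hBox, mem_filter, mem_product, mem_Icc, mem_Icc] at hv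
    obtain ⟨⟨hm, hn⟩, hv0⟩ := hv
    set β : 𝓞 K := (v.1 : 𝓞 K) + (v.2 : 𝓞 K) * θint with hβ
    have hβcoord : β = coordElt (v.1, v.2, 0) := intCast_add_mul_θint_eq_coordElt v.1 v.2
    have hβ0 : β ≠ 0 := by
      intro h0
      rw [hβcoord] at h0
      have : (v.1, v.2, (0 : ℤ)) = 0 := coordElt_injective (h0.trans (by simp [coordElt]))
      apply hv0
      simp only [Prod.ext_iff, Prod.fst_zero, Prod.snd_zero] at this
      exact Prod.ext this.1 this.2.1
    have hI0 : Ideal.span {β} ≠ ⊥ := by rwa [Ne, Ideal.span_singleton_eq_bot]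
    have hnorm : (Ideal.absNorm (Ideal.span {β}) : ℝ) ≤ (Y : ℝ) ^ 12 := by
      have h1 := absNorm_span_coordElt_le (v.1, v.2, 0)
      rw [← hβcoord] at h1
      simp only [Int.cast_zero, abs_zero, add_zero] at h1
      have hm' : |(v.1 : ℝ)| ≤ Y := by
        rw [abs_le]; constructor
        · have : (-(Y : ℤ) : ℝ) ≤ v.1 := by exact_mod_cast (by omega : -(Y : ℤ) ≤ v.1)
          push_cast at this; exact this
        · exact_mod_cast (by omega : v.1 ≤ (Y : ℤ))
      have hn' : |(v.2 : ℝ)| ≤ Y := by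
        rw [abs_le]; constructor
        · have : (-(Y : ℤ) : ℝ) ≤ v.2 := by exact_mod_cast hn.1
          push_cast at this; exact this
        · exact_mod_cast hn.2
      calc (Ideal.absNorm (Ideal.span {β}) : ℝ) ≤ 64 * (|(v.1 : ℝ)| + |(v.2 : ℝ)|) ^ 3 := h1
        _ ≤ 64 * ((Y : ℝ) + Y) ^ 3 := by gcongr
        _ = 512 * (Y : ℝ) ^ 3 := by ring
        _ ≤ (Y : ℝ) ^ 9 * (Y : ℝ) ^ 3 := by
            gcongr
            calc (512 : ℝ) = 2 ^ 9 := by norm_num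
              _ ≤ (Y : ℝ) ^ 9 := pow_le_pow_left₀ (by norm_num) hY' 9
        _ = (Y : ℝ) ^ 12 := by ring
    obtain ⟨J, hJdvd, hJnorm, hτ⟩ := HeathBrown2001_lemma_4_4 (n := 12) (by norm_num) hI0
    have hJ0 : J ≠ ⊥ := by rintro rfl; exact hI0 (zero_dvd_iff.mp hJdvd)
    have hJY : Ideal.absNorm J ≤ Y := by
      have h1 : (Ideal.absNorm J : ℝ) ≤ Y := by
        refine hJnorm.trans ?_
        calc (Ideal.absNorm (Ideal.span {β}) : ℝ) ^ ((12 : ℕ) : ℝ)⁻¹ ≤ ((Y : ℝ) ^ 12) ^ ((12 : ℕ) : ℝ)⁻¹ :=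
              Real.rpow_le_rpow (by positivity) hnorm (by positivity)
          _ = Y := by
              rw [← Real.rpow_natCast, ← Real.rpow_mul hYpos.le]; norm_num
      exact_mod_cast Nat.le_floor h1 |>.trans (Nat.floor_natCast Y).le
    have hJT : J ∈ T.filter (fun J => β ∈ J) := by
      rw [mem_filter, hT, mem_filter, mem_idealsLE]
      exact ⟨⟨hJY, hJ0⟩, Ideal.dvd_span_singleton.mp hJdvd⟩
    have hτR : (idealDivisorCount (Ideal.span {β}) : ℝ) ≤ 2 ^ 11 * (idealDivisorCount J : ℝ) ^ 23 := by
      exact_mod_cast hτ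
    calc (idealDivisorCount (Ideal.span {β}) : ℝ) ^ A ≤ (2 ^ 11 * (idealDivisorCount J : ℝ) ^ 23) ^ A :=
          pow_le_pow_left₀ (by positivity) hτR A
      _ = 2 ^ (11 * A) * (idealDivisorCount J : ℝ) ^ c := by
          rw [mul_pow, ← pow_mul, ← pow_mul, hc]
      _ ≤ 2 ^ (11 * A) * ∑ J' ∈ T.filter (fun J => β ∈ J), (idealDivisorCount J' : ℝ) ^ c := by
          refine mul_le_mul_of_nonneg_left ?_ (by positivity)
          exact single_le_sum (f := fun J' => (idealDivisorCount J' : ℝ) ^ c)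
            (fun J' _ => by positivity) hJT
  -- Step 2: sum over the box and swap
  have hswap : ∑ v ∈ Box, ∑ J ∈ T.filter (fun J => (v.1 : 𝓞 K) + (v.2 : 𝓞 K) * θint ∈ J),
      (idealDivisorCount J : ℝ) ^ c =
      ∑ J ∈ T, (idealDivisorCount J : ℝ) ^ c *
        #(Box.filter (fun v => (v.1 : 𝓞 K) + (v.2 : 𝓞 K) * θint ∈ J)) := by
    simp only [sum_filter]
    rw [sum_comm]
    refine sum_congr rfl fun J _ => ?_
    rw [← sum_filter, sum_const, nsmul_eq_mul, mul_comm]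
  -- Step 3: the count
  have hcount : ∀ J ∈ T, (#(Box.filter (fun v => (v.1 : 𝓞 K) + (v.2 : 𝓞 K) * θint ∈ J)) : ℝ) ≤
      (2 * X + 1) * (4 * Y / idealNu J + 1) := by
    intro J hJ
    have hJ0 : J ≠ ⊥ := (mem_filter.mp hJ).2
    refine le_trans ?_ (card_box_filter_mem_le' hJ0 X Y)
    exact_mod_cast card_le_card (fun v hv => by
      rw [mem_filter] at hv ⊢
      exact ⟨(mem_filter.mp hv.1).1, hv.2⟩)
  -- Step 4: the two divisor sums
  have hsum1 := hν Y hY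
  have hsum2 := h42 Y hY
  have hνpos : ∀ J ∈ T, (0 : ℝ) < idealNu J := fun J hJ => by
    exact_mod_cast idealNu_pos (mem_filter.mp hJ).2
  calc ∑ v ∈ Box, (idealDivisorCount (Ideal.span {(v.1 : 𝓞 K) + (v.2 : 𝓞 K) * θint}) : ℝ) ^ A
      ≤ ∑ v ∈ Box, 2 ^ (11 * A) * ∑ J ∈ T.filter (fun J => (v.1 : 𝓞 K) + (v.2 : 𝓞 K) * θint ∈ J),
          (idealDivisorCount J : ℝ) ^ c := sum_le_sum hpt
    _ = 2 ^ (11 * A) * ∑ J ∈ T, (idealDivisorCount J : ℝ) ^ c *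
          #(Box.filter (fun v => (v.1 : 𝓞 K) + (v.2 : 𝓞 K) * θint ∈ J)) := by
        rw [← mul_sum, hswap]
    _ ≤ 2 ^ (11 * A) * ∑ J ∈ T, (idealDivisorCount J : ℝ) ^ c * ((2 * X + 1) * (4 * Y / idealNu J + 1)) := by
        gcongr with J hJ
        exact hcount J hJ
    _ = 2 ^ (11 * A) * (2 * X + 1) * (4 * Y * ∑ J ∈ T, (idealDivisorCount J : ℝ) ^ c / idealNu J +
          ∑ J ∈ T, (idealDivisorCount J : ℝ) ^ c) := by
        have key : (2 * X + 1 : ℝ) * (4 * Y * ∑ J ∈ T, (idealDivisorCount J : ℝ) ^ c / idealNu J +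
            ∑ J ∈ T, (idealDivisorCount J : ℝ) ^ c) =
            ∑ J ∈ T, (idealDivisorCount J : ℝ) ^ c * ((2 * X + 1) * (4 * Y / idealNu J + 1)) := by
          rw [mul_add, ← mul_assoc, mul_sum, mul_sum, ← sum_add_distrib]
          refine sum_congr rfl fun J hJ => ?_
          have := hνpos J hJ
          field_simp
        rw [mul_assoc, key]
    _ ≤ 2 ^ (11 * A) * (3 * X) * (4 * Y * (C₁ * Real.log Y ^ e₁) + C₂ * Y * Real.log Y ^ e₂) := by
        have h3 : (2 * X + 1 : ℝ) ≤ 3 * X := by linarith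
        have hS0 : 0 ≤ 4 * Y * ∑ J ∈ T, (idealDivisorCount J : ℝ) ^ c / idealNu J +
            ∑ J ∈ T, (idealDivisorCount J : ℝ) ^ c := by positivity
        gcongr
    _ ≤ 2 ^ (11 * A) * (3 * X) * (4 * Y * (C₁ * Real.log ((X : ℝ) * Y) ^ E) +
          C₂ * Y * Real.log ((X : ℝ) * Y) ^ E) := by
        gcongr
        · exact hpowY he₁ (le_max_left _ _)
        · rw [← Real.rpow_natCast]
          exact hpowY (by positivity) (by rw [hE]; exact_mod_cast le_max_right _ _)
    _ = 2 ^ (11 * A) * 3 * (4 * C₁ + C₂) * X * Y * Real.log ((X : ℝ) * Y) ^ E := by ring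

/-! ### Lemma 4.7 for real `x, y ≥ 2`, and the discharge of Lemma 3.2 -/

open scoped Classical in
/-- **Lemma 4.7 in the rendering of `HeathBrownCubicTypeIProofs`**: for every `A ≥ 1` there are
`c, C ≥ 0` with `∑_{0<|m|≤x} ∑_{0<|n|≤y} τ((m + n·2^{1/3}))^A ≤ C xy (log xy)^c` for all real
`x, y ≥ 2` (from `HeathBrown2001_lemma_4_7` for `⌊y⌋ ≤ ⌊x⌋` and `sum_box_pow_le_of_le` for
`⌊x⌋ ≤ ⌊y⌋`; the terms with `m = 0` or `n = 0` are dropped). [cite: HeathBrownActa2001, Lemma 4.7] -/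
theorem lemma_4_7_bound_holds (A : ℕ) (_ : 0 < A) :
    ∃ c C : ℝ, 0 ≤ c ∧ 0 ≤ C ∧ ∀ x y : ℝ, 2 ≤ x → 2 ≤ y →
      ∑ m ∈ (Icc (-⌊x⌋) ⌊x⌋).filter (· ≠ 0), ∑ n ∈ (Icc (-⌊y⌋) ⌊y⌋).filter (· ≠ 0),
        (idealDivisorCount (Ideal.span {((m : ℤ) : 𝓞 K) + ((n : ℤ) : 𝓞 K) * θint}) : ℝ) ^ A ≤
      C * x * y * Real.log (x * y) ^ c := by
  obtain ⟨C₁, e₁, hC₁, he₁, H₁⟩ := HeathBrown2001_lemma_4_7 A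
  obtain ⟨C₂, e₂, hC₂, he₂, H₂⟩ := sum_box_pow_le_of_le A
  set E : ℝ := max e₁ e₂ with hE
  refine ⟨E, C₁ + C₂, by positivity, by positivity, fun x y hx hy => ?_⟩
  set X : ℕ := ⌊x⌋₊ with hX
  set Y : ℕ := ⌊y⌋₊ with hY
  have hx0 : 0 ≤ x := by linarith
  have hy0 : 0 ≤ y := by linarith
  have hX2 : 2 ≤ X := Nat.le_floor (by exact_mod_cast hx)
  have hY2 : 2 ≤ Y := Nat.le_floor (by exact_mod_cast hy)
  have hXx : (X : ℝ) ≤ x := Nat.floor_le hx0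
  have hYy : (Y : ℝ) ≤ y := Nat.floor_le hy0
  have hX' : (2 : ℝ) ≤ X := by exact_mod_cast hX2
  have hY' : (2 : ℝ) ≤ Y := by exact_mod_cast hY2
  have hfx : ⌊x⌋ = (X : ℤ) := (Int.natCast_floor_eq_floor hx0).symm
  have hfy : ⌊y⌋ = (Y : ℤ) := (Int.natCast_floor_eq_floor hy0).symm
  rw [hfx, hfy]
  -- the double sum over `m ≠ 0`, `n ≠ 0` is at most the box sum over `(m, n) ≠ 0`
  set Box := ((Icc (-(X : ℤ)) X) ×ˢ (Icc (-(Y : ℤ)) Y)).filter (· ≠ (0 : ℤ × ℤ)) with hBox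
  have hle : ∑ m ∈ (Icc (-(X : ℤ)) X).filter (· ≠ 0), ∑ n ∈ (Icc (-(Y : ℤ)) Y).filter (· ≠ 0),
        (idealDivisorCount (Ideal.span {((m : ℤ) : 𝓞 K) + ((n : ℤ) : 𝓞 K) * θint}) : ℝ) ^ A ≤
      ∑ v ∈ Box, (idealDivisorCount (Ideal.span {(v.1 : 𝓞 K) + (v.2 : 𝓞 K) * θint}) : ℝ) ^ A := by
    rw [← sum_product' (f := fun m n =>
      (idealDivisorCount (Ideal.span {((m : ℤ) : 𝓞 K) + ((n : ℤ) : 𝓞 K) * θint}) : ℝ) ^ A)]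
    refine sum_le_sum_of_subset_of_nonneg ?_ fun v _ _ => by positivity
    intro v hv
    rw [mem_product, mem_filter, mem_filter] at hv
    rw [hBox, mem_filter, mem_product]
    refine ⟨⟨hv.1.1, hv.2.1⟩, fun h0 => hv.1.2 ?_⟩
    rw [h0]; rfl
  -- logarithms
  have hXY1 : (1 : ℝ) ≤ (X : ℝ) * Y := by nlinarith
  have hlogXY0 : 0 ≤ Real.log ((X : ℝ) * Y) := Real.log_nonneg hXY1
  have hlog_le : Real.log ((X : ℝ) * Y) ≤ Real.log (x * y) :=
    Real.log_le_log (by positivity) (mul_le_mul hXx hYy (by positivity) hx0)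
  have hlogxy1 : 1 ≤ Real.log (x * y) := by
    have h4 : (4 : ℝ) ≤ x * y := by nlinarith
    have : Real.log 4 ≤ Real.log (x * y) := Real.log_le_log (by norm_num) h4
    have h2 : (1 : ℝ) ≤ Real.log 4 := by
      rw [show (4 : ℝ) = 2 ^ 2 by norm_num, Real.log_pow]
      have := Real.log_two_gt_d9; push_cast; linarith
    linarith
  have hpow : ∀ {t : ℝ}, 0 ≤ t → t ≤ E → Real.log ((X : ℝ) * Y) ^ t ≤ Real.log (x * y) ^ E := by
    intro t ht htE
    calc Real.log ((X : ℝ) * Y) ^ t ≤ Real.log (x * y) ^ t := Real.rpow_le_rpow hlogXY0 hlog_le ht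
      _ ≤ Real.log (x * y) ^ E := Real.rpow_le_rpow_of_exponent_le hlogxy1 htE
  refine hle.trans ?_
  rcases le_total Y X with hYX | hXY
  · calc ∑ v ∈ Box, (idealDivisorCount (Ideal.span {(v.1 : 𝓞 K) + (v.2 : 𝓞 K) * θint}) : ℝ) ^ A
        ≤ C₁ * X * Y * Real.log ((X : ℝ) * Y) ^ e₁ := H₁ X Y hY2 hYX
      _ ≤ C₁ * x * y * Real.log (x * y) ^ E := by
          have := hpow he₁ (le_max_left _ _)
          gcongr
      _ ≤ (C₁ + C₂) * x * y * Real.log (x * y) ^ E := by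
          have : 0 ≤ C₂ * x * y * Real.log (x * y) ^ E := by positivity
          nlinarith
  · calc ∑ v ∈ Box, (idealDivisorCount (Ideal.span {(v.1 : 𝓞 K) + (v.2 : 𝓞 K) * θint}) : ℝ) ^ A
        ≤ C₂ * X * Y * Real.log ((X : ℝ) * Y) ^ e₂ := H₂ X Y hX2 hXY
      _ ≤ C₂ * x * y * Real.log (x * y) ^ E := by
          have := hpow he₂ (le_max_right _ _)
          gcongr
      _ ≤ (C₁ + C₂) * x * y * Real.log (x * y) ^ E := by
          have : 0 ≤ C₁ * x * y * Real.log (x * y) ^ E := by positivity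
          nlinarith

/-- **Heath-Brown's Lemma 3.2 (the Type I estimate `(A)` of `HeathBrownCubicSieveSetup`) holds.**
[cite: HeathBrownActa2001, Lemma 3.2] -/
theorem HeathBrown2001_typeI_A_holds : HeathBrown2001_typeI_A :=
  HeathBrown2001_typeI_A_of_lemma_4_7 lemma_4_7_bound_holds

end Literature.NumberTheory.Sieve.CubicSieve

end
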